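import Literature.AlgebraicGeometry.Deformation.AdaptedObstructionTrace
import Literature.AlgebraicGeometry.Modules.CechThetaTrace
import Literature.AlgebraicGeometry.Modules.CechEndCochainFamily
import HarnessLib

/-!
# `Tr` of the obstruction class is additive along a short exact sequence (class level)

Setting of `Deformation/AdaptedObstructionTrace.lean`: `j : Y ⟶ Z₀`, `i : Z₀ ⟶ Z₁`,
`eI : i_* j_* 𝒪_Y ≅ 𝓘`, a short exact sequence `0 → F₁ → F₂ → F₃ → 0` of `𝒪_{Z₀}`-modules with
`j^*F_k` finite locally free, an adapted frame cover `A` with lifts `T̃¹`, `T̃³` and the adapted lifts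
`T̃² = [[T̃¹, X], [0, T̃³]]`; the three obstruction cocycles `ωᵏ = toLocalFamily κ(cᵏ)` live on the
same cover `(j⁻¹i⁻¹U_a)_a` of `Y`.

* `trace_toLocalFamily_defectCochain_adapted` — the local traces add up on every simplex:
  `tr(ω²_β) = tr(ω¹_β) + tr(ω³_β) ∈ Γ(Y, U^Y_β)` (from the `locOp` form
  `trace_locOp_defectCochain_adapted` over `⊤ ∩ U^Y_β`);
* `traceExt_classOf_defectCochain_adapted` — hence **`Tr[ω²] = Tr[ω¹] + Tr[ω³] ∈ Ext²(𝒪_Y, 𝒪_Y)`**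
  for the `Ext`-classes of the three obstruction cocycles (`Cech.traceExt_classOf_eq_add`,
  `Modules/CechThetaTrace.lean`): the cochain-to-class step of the additivity of `σ₀ ∘ ob` over short
  exact sequences (Buchweitz–Flenner 2003, Prop. 4.2 with 4.4).

Everything is proved; no named facts.

## References

* R.-O. Buchweitz, H. Flenner, Compositio Math. 137 (2003), Prop. 4.2, Prop. 4.4. [BuchweitzFlenner2003]
* R. Hartshorne, *Deformation Theory*, GTM 257 (2010), §7, Thm. 7.1. [Hartshorne2010]
-/

noncomputable section

open CategoryTheory CategoryTheory.Abelian AlgebraicGeometry Opposite TopologicalSpace Limits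

universe u

namespace Literature.AlgebraicGeometry.Deformation

open Literature.AlgebraicGeometry.Modules Literature.AlgebraicGeometry.Motives
  Literature.AlgebraicGeometry.HodgeTheory

section Adapted

variable {Y Z₀ Z₁ : Scheme.{u}} {j : Y ⟶ Z₀} {i : Z₀ ⟶ Z₁}
  (eI : (Scheme.Modules.pushforward i).obj ((Scheme.Modules.pushforward j).obj (unitModule Y)) ≅
    idealModule i)
  {S : ShortComplex Z₀.Modules} {hS : S.ShortExact} {ι : Type u} {A : AdaptedFrameCover i S ι}
  (L₁ : A.cover₁.Lifts) (L₃ : A.cover₃.Lifts)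
  (X : ∀ a b, Matrix (A.I₁ a) (A.I₃ b) Γ(Z₁, A.U a ⊓ A.U b))
  (hX : ∀ a b, (X a b).map (i.app (A.U a ⊓ A.U b)).hom =
    A.offDiag (hS := hS) a b (A.U a ⊓ A.U b) inf_le_left inf_le_right)
  (h₁ : IsFiniteLocallyFree ((Scheme.Modules.pullback j).obj S.X₁))
  (h₂ : IsFiniteLocallyFree ((Scheme.Modules.pullback j).obj S.X₂))
  (h₃ : IsFiniteLocallyFree ((Scheme.Modules.pullback j).obj S.X₃))

/-- The trace of the local endomorphism `ω_β` of a matrix cochain of the base framing, restricted to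
`⊤ ∩ U^Y_β`, is the trace of the local operator `locOp c ⊤ β`. [folklore] -/
lemma res_trace_toLocalFamily {F : Z₀.Modules} (C : FrameCover i F ι)
    (hF : IsFiniteLocallyFree ((Scheme.Modules.pullback j).obj F)) (c : (C.baseFraming j).Cochain 2)
    (β : Fin 3 → ι) :
    Cech.res (unitModule Y) (inf_le_right : ⊤ ⊓ face (C.baseFraming j).U β ≤ face (C.baseFraming j).U β)
        ((trace hF).app _ ((C.baseFraming j).toLocalFamily c β)) =
      (trace hF).app _ ((C.baseFraming j).locOp c ⊤ β) :=
  (Cech.app_restrictHom (trace hF) inf_le_right _).symm.trans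
    (congrArg _ ((C.baseFraming j).restrictHom_toLocalFamily c β (homOfLE inf_le_right)))

/-- **The local traces of the three obstruction cocycles add up on every simplex**:
`tr(ω²_β) = tr(ω¹_β) + tr(ω³_β)` over `U^Y_β = j⁻¹i⁻¹(U_{β₀} ∩ U_{β₁} ∩ U_{β₂})`.
[cite: BuchweitzFlenner2003, Prop. 4.2] -/
theorem trace_toLocalFamily_defectCochain_adapted (β : Fin 3 → ι) :
    (trace h₂).app _ (((A.cover₂ hS).baseFraming j).toLocalFamily
        ((AdaptedFrameCover.Lifts.adapted (hS := hS) L₁ L₃ X hX).defectCochain eI) β) =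
      (trace h₁).app _ ((A.cover₁.baseFraming j).toLocalFamily (L₁.defectCochain eI) β) +
        (trace h₃).app _ ((A.cover₃.baseFraming j).toLocalFamily (L₃.defectCochain eI) β) := by
  refine Cech.sections_eq_of_res_eq (N' := unitModule Y)
    (inf_le_right : ⊤ ⊓ face (fun a => baseOpen j i (A.U a)) β ≤ face (fun a => baseOpen j i (A.U a)) β)
    (le_inf le_top le_rfl) ?_
  exact (res_trace_toLocalFamily (A.cover₂ hS) h₂ _ β).trans
    ((trace_locOp_defectCochain_adapted eI L₁ L₃ X hX h₁ h₂ h₃ ⊤ β).trans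
      (((congrArg₂ (· + ·) (res_trace_toLocalFamily A.cover₁ h₁ _ β)
        (res_trace_toLocalFamily A.cover₃ h₃ _ β)).symm).trans (map_add _ _ _).symm))

variable [HasExt.{u + 1} Y.Modules]

/-- **`Tr[ω²] = Tr[ω¹] + Tr[ω³]` in `Ext²(𝒪_Y, 𝒪_Y)`** for the `Ext`-classes of the obstruction
cocycles of `F₂`, `F₁`, `F₃` computed with the adapted data (the cochain-to-class step of the
additivity of `σ₀ ∘ ob`). [cite: BuchweitzFlenner2003, Prop. 4.2, Prop. 4.4] -/
theorem traceExt_classOf_defectCochain_adapted (hcov : iSup (fun a => baseOpen j i (A.U a)) = ⊤) :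
    traceExt h₂ 2 (Cech.classOf (Cech.exactAugmentation (fun a => baseOpen j i (A.U a)) _ hcov)
        (((A.cover₂ hS).baseFraming j).toLocalFamily
          ((AdaptedFrameCover.Lifts.adapted (hS := hS) L₁ L₃ X hX).defectCochain eI))
        (((A.cover₂ hS).baseFraming j).dFamily_toLocalFamily_eq_zero _
          ((AdaptedFrameCover.Lifts.adapted (hS := hS) L₁ L₃ X hX).D₂_defectCochain eI))) =
      traceExt h₁ 2 (Cech.classOf (Cech.exactAugmentation (fun a => baseOpen j i (A.U a)) _ hcov)
          ((A.cover₁.baseFraming j).toLocalFamily (L₁.defectCochain eI))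
          ((A.cover₁.baseFraming j).dFamily_toLocalFamily_eq_zero _ (L₁.D₂_defectCochain eI))) +
        traceExt h₃ 2 (Cech.classOf (Cech.exactAugmentation (fun a => baseOpen j i (A.U a)) _ hcov)
          ((A.cover₃.baseFraming j).toLocalFamily (L₃.defectCochain eI))
          ((A.cover₃.baseFraming j).dFamily_toLocalFamily_eq_zero _ (L₃.D₂_defectCochain eI))) :=
  Cech.traceExt_classOf_eq_add hcov h₁ h₂ h₃ _ _ _ _ _ _
    (fun β => trace_toLocalFamily_defectCochain_adapted eI L₁ L₃ X hX h₁ h₂ h₃ β)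

end Adapted

end Literature.AlgebraicGeometry.Deformation

end
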